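import Literature.MathematicalPhysics.QuantumFieldTheory.Balaban1983to89.B9Thm313WholeDir
import Literature.MathematicalPhysics.QuantumFieldTheory.Balaban1983to89.B9RWSums344InputPair

/-!
# `Balaban1983to89.B9Thm312WholeFromThm310` — [B9] Theorems 3.12–3.13 (pp. 421–426): «THEOREM 3.3 FOR G₀» OF THE SECT.-D LEAVES IS
# THEOREM 3.10's SUM — the sup ∕ Hölder ∕ input-class schemas `Thm33G0`, `LeftStep.e1`, `Thm33G0Dir`, `Thm33G0DirR` of rows 20–21
# PROVED from the Theorem-3.10 schemas of rows 18–19 through n06-k's operator-level theorems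

T. Bałaban, *Propagators for lattice gauge theories in a background field*, Commun. Math. Phys. **99** (1985) 389–434
[`Balaban1985BackgroundPropagators`, "B9"]; [4] = T. Bałaban, *Propagators and renormalization transformations for lattice gauge
theories. II*, Commun. Math. Phys. **96** (1984) 223–250 [`Balaban1984PropagatorsII`].

statement-level skeleton of published theorems with citation tags; proofs where landed; nothing here is a claim about the Yang–Mills
mass gap

THE PRINTED LOCUS (p. 421, verbatim, held text `paper:balaban1985-cmp99-background-propagators`): *"Now we will prove that Theorems
3.3, 3.10, 3.11 hold for the propagators G, G₁. … Let us denote for a moment the operator we have investigated in previous sections by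
G₀, i.e. G₀ = (Δ + DRD\* + Q\*aQ)⁻¹"*; p. 422: *"This inequality [(3.131)] and Theorem 3.3 for G₀ imply a convergence of the series
(3.130)"*; p. 416 (Theorem 3.10): *"From (3.108) it follows that the expansion (3.107) is convergent in all norms in the inequalities
(3.42)–(3.47)"*; p. 399 (Theorem 3.3): *"the operator G(U) (a = 1) satisfies the inequalities (3.42)–(3.47)"*.

THE POINT.  The Sect.-D leaves of this lineage (`B9Thm312WholeLeafCompletePairM.thm312Printed_completePairM`, row 20, and
`B9Thm313WholeLeafCompletePairM.thm313Printed_completePairM`, row 21, consumed at def-Y's instance by n06-d's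
`N06Thm312313AtPinsPairM.t312_t313_of_pins_pairM`) display *"Theorem 3.3 for G₀"* as HYPOTHESIS SCHEMAS on a letter record
`𝔬 : B9Thm312Whole.Ops` — `Thm33G0` ((3.42)₁,₃), `LeftStep.e1` ((3.42)₂), `Thm33G0Dir` ∕ `Thm33G0DirR` (the (3.43) probes, the
direction-indexed (3.42)₂,₃ and the (3.44)∕(3.45) input members per direction pair), `Thm33G0L2M` ((3.46)).  But G₀ IS the operator of
Theorem 3.3 = the SUM G(U) of Theorem 3.10's expansion (3.107), for which rows 18–19 of the same certificate ALREADY display n06-k's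
Theorem-3.10 schemas (`B9Thm310Whole.Local342G ∕ Factors389 ∕ Identities310`, `B9RWSums343Holder.HolderLegs310 ∕ FactorsHolder310`,
`B9RWSums344InputPair.InputLegsPair310 ∕ FactorsInputPair310 ∕ DirSupHolder310`, `B9RWSums346MixedPair.DirSup310`, …) on a letter
record `𝔬' : B9Thm310Whole.Ops310`, and n06-k PROVED the operator-level consequences: `conv3107_of_local3107` (the four (3.42) sup
majorants of G(U), `Conv3107`), `holder343_of_local310` (the two (3.43) probe majorants), `inputPair3445_of_local310` (the
(3.44)∕(3.45) members per direction pair).  THIS FILE composes them: under the letter identification G₀ := G (`𝔬.G0 U = 𝔬'.G U`) and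
equal block maps ∕ derivative letters (`blk`, `blkY`, `∇_U`, `∇\*_U` — at def-Y's pins both records read the same coordinate models),
the rows-20–21 schemas `Thm33G0`, `LeftStep` (its `e1` field; the two step fields stay displayed), `Thm33G0DirR` and `Thm33G0Dir`
FOLLOW from `Conv3107` and the rows-18–19 leg schemas — so that the knit can display Theorem 3.3 for G₀ ONCE (as rows 18's schemas)
instead of twice.  The L² schema `Thm33G0L2M` is the sequel `…B9Thm312WholeFromThm310L2`.

* §1 `thm33G0_of_conv3107`, `e1_of_conv3107`, `leftStep_of_conv3107`, `thm33G0DirR_of_conv3107` — the sup members: conjuncts of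
  `Conv3107` (and `DirSup310.right` for the per-direction right entry), rate weakened to any ρ ≦ δ.
* §2 ★ `thm33G0Dir_of_conv3107` — the Hölder probes (`holder343_of_local310`), the per-direction left entry (`DirSup310.left`), its probe
  (`DirSupHolder310.probe`) and the input members (`inputPair3445_of_local310`), with the constants `holderConst`, `inputConst44`,
  `inputConst45` of n06-k and one common rate ρ ≦ (1 − α)δ (α = the exponent of p. 398's scale transfer in `Facts347`).

HONEST SCOPE.  Kernel bookkeeping over landed modules: NOTHING of print is asserted and NO new hypothesis species is introduced —
every hypothesis below is either n06-k's displayed Theorem-3.10 schema (rows 18–19 of the certificate), n06-k's member facts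
`Facts347` ∕ `StaticOK310` ∕ [4] Lemma 2.1 (`Ineq261`), or a letter equation.  COUNT-NEUTRAL (it moves displayed hypotheses of rows
20–21 onto the displayed hypotheses of rows 18–19); N06 NOT discharged; one finite lattice at a time; nothing continuum, nothing about
the mass gap.  Cell `pub-ymgap` (HUMAN RULING D-0062), Track A node N06 [B9], N06-ASSIGNMENT v1 rows 20–21 (bundle F7), seat
`pub-ymgap-dag-n06-l` (g10), 2026-08-27.
-/

namespace Literature.MathematicalPhysics.QuantumFieldTheory.Balaban1983to89.B9Thm312WholeFromThm310

open Literature.MathematicalPhysics.QuantumFieldTheory.Balaban1983to89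
open Finset B6RandomWalk B6RandomWalkHom B9Thm34Ext B11SectG B9Thm37Glue
open B9Thm312Whole B9Thm312WholeLeft B9Thm312WholeClasses B9Thm312WholeDir B9Thm313WholeDir
open B9Thm310Whole B9RWSums343Holder B9RWSums343to347Whole B9RWSums344Input B9RWSums344InputPair B9RWSums346MixedPair
open B9RWSums346SecondDiff

noncomputable section

variable {g : B9.Geometry} {B : B9.Backgrounds} {X Y Z W ι A PX PY P : Type} [Fintype g.Site]
variable {R : ℝ} {H : Prop}

/-! ## §0 Two elementary weakenings -/

/-- Weakening the rate of a decaying majorant: C·w·e^{−δd} ≦ C·w·e^{−ρd} for ρ ≦ δ, d ≧ 0, C·w ≧ 0. [folklore] -/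
private theorem mul_exp_le_of_rate_le {C δ ρ d : ℝ} (hC : 0 ≤ C) (hρ : ρ ≤ δ) (hd : 0 ≤ d) :
    C * Real.exp (-(δ * d)) ≤ C * Real.exp (-(ρ * d)) :=
  mul_le_mul_of_nonneg_left (Real.exp_le_exp.mpr (neg_le_neg (mul_le_mul_of_nonneg_right hρ hd))) hC

/-- n06-k's Hölder constant `holderConst` is ≧ 0 for nonnegative letters (its own nonnegativity lemma is private). [folklore] -/
private theorem holderConst_nonneg' {d : ℕ} {δ₀ α NH NF C b t : ℝ} (hNH : 0 ≤ NH) (hNF : 0 ≤ NF) (hC : 0 ≤ C) (hb : 0 ≤ b)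
    (ht : 0 ≤ t) : 0 ≤ holderConst d δ₀ α NH NF C b t := by
  have hc1 : 0 ≤ B6.c1 d δ₀ α := c1_nonneg d δ₀ α
  unfold holderConst
  have h1 : 0 ≤ 2 * NH * b * B6.c1 d δ₀ α := mul_nonneg (mul_nonneg (mul_nonneg (by norm_num) hNH) hb) hc1
  have h2 : 0 ≤ NH * b := mul_nonneg hNH hb
  have h3 : 0 ≤ NF * t * C * B6.c1 d δ₀ α := mul_nonneg (mul_nonneg (mul_nonneg hNF ht) hC) hc1
  linarith

/-- n06-k's (3.44) constant `inputConst44` is ≧ 0 for nonnegative letters. [folklore] -/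
private theorem inputConst44_nonneg' {d₁ : ℕ} {δ₁ α₁ NI NF C L₀ b t : ℝ} (hNI : 0 ≤ NI) (hNF : 0 ≤ NF) (hC : 0 ≤ C)
    (hL₀ : 0 ≤ L₀) (hb : 0 ≤ b) (ht : 0 ≤ t) : 0 ≤ inputConst44 d₁ δ₁ α₁ NI NF C L₀ b t := by
  have hc1 : 0 ≤ B6.c1 d₁ δ₁ α₁ := c1_nonneg d₁ δ₁ α₁
  unfold inputConst44
  exact add_nonneg (mul_nonneg hNI hb) (mul_nonneg (mul_nonneg (mul_nonneg hC (mul_nonneg hNF ht)) hL₀) hc1)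

/-- n06-k's (3.45) constant `inputConst45` is ≧ 0 for nonnegative letters. [folklore] -/
private theorem inputConst45_nonneg' {d₁ : ℕ} {δ₁ α₁ NI NF L₀ hc b t : ℝ} (hNI : 0 ≤ NI) (hNF : 0 ≤ NF) (hL₀ : 0 ≤ L₀)
    (hhc : 0 ≤ hc) (hb : 0 ≤ b) (ht : 0 ≤ t) : 0 ≤ inputConst45 d₁ δ₁ α₁ NI NF L₀ hc b t := by
  have hc1 : 0 ≤ B6.c1 d₁ δ₁ α₁ := c1_nonneg d₁ δ₁ α₁
  unfold inputConst45
  exact add_nonneg (mul_nonneg hNI hb) (mul_nonneg (mul_nonneg (mul_nonneg hhc (mul_nonneg hNF ht)) hL₀) hc1)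

/-! ## §1 The sup members: `Thm33G0`, `LeftStep`, `Thm33G0DirR` from `Conv3107` -/

section Sup

variable [Fintype X] [Fintype Y]

omit [Fintype X] [Fintype Y] in
/-- ★ **THEOREM 3.3 (3.42)₁,₃ FOR G₀ := THEOREM 3.10's SUM G(U)** — the rows-20–21 schema `Thm33G0 𝔬 R H C ρ U` from n06-k's
operator-level conclusion `Conv3107 𝔬' R H C δ U` (*"the expansion (3.107) is convergent in all norms in the inequalities
(3.42)–(3.47)"*, read on the sum) under the letter identification G₀ = G (p. 421) and equal block maps ∕ ∇\*_U letters, at any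
rate ρ ≦ δ. [cite: Balaban1985BackgroundPropagators, Thm 3.10 p.416 + Thm 3.3 p.399 + p.421 + (3.42) p.397] -/
theorem thm33G0_of_conv3107 (𝔬 : B9Thm312Whole.Ops g B X Y Z W) (𝔬' : Ops310 g B X Y ι A) {C δ ρ : ℝ} {U : B.Cfg}
    (hblk : 𝔬.blk = 𝔬'.blk) (hblkY : 𝔬.blkY = 𝔬'.blkY) (hG0 : 𝔬.G0 U = 𝔬'.G U) (hDs : 𝔬.Dstar U = 𝔬'.Dstar U)
    (hC : 0 ≤ C) (hρ : ρ ≤ δ) (hdnn : ∀ y y' : g.Site, 0 ≤ g.dist y y') (hlen : ∀ y : g.Site, 0 ≤ g.len y)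
    (hc : Conv3107 𝔬' R H C δ U) : Thm33G0 𝔬 R H C ρ U where
  e0 := by
    rw [hblk, hG0]
    exact hasMajorant_mono (g := toB6 g R H) _ hc.1 fun a b => by
      have h := mul_exp_le_of_rate_le (mul_nonneg hC (sq_nonneg (g.len a))) hρ (hdnn a b)
      simpa only [mul_assoc] using h
  e2 := by
    rw [hblk, hblkY, hG0, hDs]
    exact hasMajorantHom_mono (g := toB6 g R H) _ _ hc.2.2.1 fun a b => by
      have h := mul_exp_le_of_rate_le (mul_nonneg hC (hlen a)) hρ (hdnn a b)
      simpa only [mul_assoc] using h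

omit [Fintype X] [Fintype Y] in
/-- **(3.42)₂ FOR G₀ := G(U)** — the `e1` member of the rows-20–21 schema `LeftStep` (the sup majorant C·Lʲη·e^{−ρd} of ∇_UG₀), the second
conjunct of `Conv3107`, at any rate ρ ≦ δ. [cite: Balaban1985BackgroundPropagators, Thm 3.10 p.416 + Thm 3.3 p.399 + (3.42) p.397] -/
theorem e1_of_conv3107 (𝔬 : B9Thm312Whole.Ops g B X Y Z W) (𝔬' : Ops310 g B X Y ι A) {C δ ρ : ℝ} {U : B.Cfg}
    (hblk : 𝔬.blk = 𝔬'.blk) (hblkY : 𝔬.blkY = 𝔬'.blkY) (hG0 : 𝔬.G0 U = 𝔬'.G U) (hD : 𝔬.D U = 𝔬'.D U)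
    (hC : 0 ≤ C) (hρ : ρ ≤ δ) (hdnn : ∀ y y' : g.Site, 0 ≤ g.dist y y') (hlen : ∀ y : g.Site, 0 ≤ g.len y)
    (hc : Conv3107 𝔬' R H C δ U) :
    HasMajorantHom (g := toB6 g R H) 𝔬.blk 𝔬.blkY (𝔬.D U ∘ₗ 𝔬.G0 U)
      (fun (a b : g.Site) => C * g.len a * Real.exp (-(ρ * g.dist a b))) := by
  rw [hblk, hblkY, hG0, hD]
  exact hasMajorantHom_mono (g := toB6 g R H) _ _ hc.2.1 fun a b => by
    have h := mul_exp_le_of_rate_le (mul_nonneg hC (hlen a)) hρ (hdnn a b)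
    simpa only [mul_assoc] using h

/-- **THE ROWS-20–21 SCHEMA `LeftStep` WITH ITS THEOREM-3.3 MEMBER PROVED**: `e1` from `Conv3107` (G₀ := G(U)); the two Sect.-D step
fields ∇_UG₀Δ′_π, ∇_UG₀(Δ′_π + Δ⁽²⁾_π) : 𝔠⁽²⁾ → 𝔠_Y⁽¹⁾ ((3.131)∕(3.137), the located gap G-B9-16) remain HYPOTHESES, passed through.
[cite: Balaban1985BackgroundPropagators, Thm 3.10 p.416 + (3.42) p.397 + (3.130)–(3.131) pp.421–422 + (3.137)–(3.138) p.423] -/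
theorem leftStep_of_conv3107 (𝔬 : B9Thm312Whole.Ops g B X Y Z W) (𝔬' : Ops310 g B X Y ι A) {C δ ρ θ δK : ℝ} {U : B.Cfg}
    (hlen : ∀ y : g.Site, 0 ≤ g.len y)
    (hblk : 𝔬.blk = 𝔬'.blk) (hblkY : 𝔬.blkY = 𝔬'.blkY) (hG0 : 𝔬.G0 U = 𝔬'.G U) (hD : 𝔬.D U = 𝔬'.D U)
    (hC : 0 ≤ C) (hρ : ρ ≤ δ) (hdnn : ∀ y y' : g.Site, 0 ≤ g.dist y y') (hc : Conv3107 𝔬' R H C δ U)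
    (hsd : HasMaj (cNorm R H 𝔬.blk hlen 2) (cNorm R H 𝔬.blkY hlen 1) (𝔬.D U ∘ₗ 𝔬.G0 U ∘ₗ 𝔬.Tpi U)
      (fun a b => θ * Real.exp (-(δK * (toB6 g R H).dist a b))))
    (hsd1 : HasMaj (cNorm R H 𝔬.blk hlen 2) (cNorm R H 𝔬.blkY hlen 1) (𝔬.D U ∘ₗ 𝔬.G0 U ∘ₗ (𝔬.Tpi U + 𝔬.T2 U))
      (fun a b => θ * Real.exp (-(δK * (toB6 g R H).dist a b)))) :
    LeftStep 𝔬 R H hlen C ρ θ δK U :=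
  ⟨e1_of_conv3107 𝔬 𝔬' hblk hblkY hG0 hD hC hρ hdnn hlen hc, hsd, hsd1⟩

/-- **(3.42)₃ FOR G₀ := G(U) PER DIRECTION** — the row-21 schema `Thm33G0DirR 𝔬 Dsd R H C ρ U` (the sup majorant C·Lʲη·e^{−ρd} of every
component G₀∇\*_{U,μ}) from `Conv3107`'s third conjunct through n06-k's letter schema `DirSup310.right` (the direction letters are
components of the bundled one), at any rate ρ ≦ δ. [cite: Balaban1985BackgroundPropagators, Thm 3.10 p.416 + (3.42) p.397 + (3.39) p.397] -/
theorem thm33G0DirR_of_conv3107 (𝔬 : B9Thm312Whole.Ops g B X Y Z W) (𝔬' : Ops310 g B X Y ι A) (𝔡 : DirOps310 𝔬' P)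
    {C δ ρ : ℝ} {U : B.Cfg} (hblk : 𝔬.blk = 𝔬'.blk) (hG0 : 𝔬.G0 U = 𝔬'.G U)
    (hC : 0 ≤ C) (hρ : ρ ≤ δ) (hdnn : ∀ y y' : g.Site, 0 ≤ g.dist y y') (hlen : ∀ y : g.Site, 0 ≤ g.len y)
    (hc : Conv3107 𝔬' R H C δ U) (hDS : DirSup310 𝔬' 𝔡 R H U) : Thm33G0DirR 𝔬 𝔡.Dsd R H C ρ U where
  e2d μ := by
    rw [hblk, hG0]
    exact hasMajorantHom_mono (g := toB6 g R H) _ _ (hDS.right _ hc.2.2.1 μ) fun a b => by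
      have h := mul_exp_le_of_rate_le (mul_nonneg hC (hlen a)) hρ (hdnn a b)
      simpa only [mul_assoc] using h

end Sup

/-! ## §2 The Hölder probes, the direction-indexed entries and the input members: `Thm33G0Dir` -/

section Holder

variable [DecidableEq g.Site] [Fintype X] [DecidableEq X] [Fintype Y] [DecidableEq Y] [Fintype ι] [Fintype A]
variable [Fintype PX] [DecidableEq PX] [Fintype PY] [DecidableEq PY]

/-- ★★ **THEOREM 3.3 FOR G₀ := G(U) IN THE HÖLDER AND INPUT CLASSES, DIRECTION-INDEXED** — the rows-20–21 schema
`Thm33G0Dir 𝔬 𝔭 Dd Dsd R H bHX C B_h B_i B_i2 ρ U` from the rows-18–19 material: the (3.43) probe members `h43L ∕ h43R` by n06-k's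
`holder343_of_local310` (legs `HolderLegs310`, factors `FactorsHolder310`, the fixed point (3.106) via `Identities310`, the smallness
N_F·θ₀M⁻¹·c₁ ≦ ½, the right sup entry of `Conv3107`); the per-direction left entry `e1d` by `DirSup310.left`; its probe `h43d` by
`DirSupHolder310.probe`; the input members `h44m ∕ h45m` by n06-k's `inputPair3445_of_local310` (legs `InputLegsPair310`, factors
`FactorsInputPair310`, member facts `Facts347` for p. 398's scale transfer).  Constants: B_h(β) = `holderConst d₁ δ₀ α₁ NH NF C (Bl β) (θH β)`,
B_i(ε) = `inputConst44 d₁ δ₀ α₁ NI NF C L₀ (BI ε) (θI ε)`, B_i2(ε, β) = `inputConst45 d₁ δ₀ α₁ NI NF L₀ (B_h β) (BI2 ε β) (θI (β + ε))`; one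
common rate ρ ≦ (1 − α)δ (δ = the rate of `Conv3107`, δ ≦ (1 − α₁)δ₀ with δ₀ the legs' rate; α = the transfer exponent of `Facts347`).
Nothing of print asserted. [cite: Balaban1985BackgroundPropagators, Thm 3.10 (3.105)–(3.108) pp.414–416 + Thm 3.3 p.399 + (3.42)–(3.45) pp.397–398 + (3.39)–(3.40) p.397 + p.413; Balaban1984PropagatorsII, (2.52)–(2.55) p.232 + Lemma 2.1 p.234] -/
theorem thm33G0Dir_of_conv3107 (𝔬 : B9Thm312Whole.Ops g B X Y Z W) (𝔬' : Ops310 g B X Y ι A) (𝔡 : DirOps310 𝔬' P)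
    (𝔭 : HolderProbes g B X Y PX PY) (bHX : ℝ → BlockNorm (toB6 g R H) (X → ℝ))
    (d d₁ : ℕ) (δ α L₀ δ₀ α₁ ρ' N N' NF Cℓ θ₀ NH NI C ρ : ℝ) (κ : Sizes310)
    (SH SI : ι → Finset g.Site) (Bl θH BI θI : ℝ → ℝ) (BI2 : ℝ → ℝ → ℝ) (U : B.Cfg)
    -- the letter identifications (G₀ := G; at def-Y's pins both records read the same coordinate models)
    (hblk : 𝔬.blk = 𝔬'.blk) (hblkY : 𝔬.blkY = 𝔬'.blkY) (hG0 : 𝔬.G0 U = 𝔬'.G U) (hD : 𝔬.D U = 𝔬'.D U)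
    (hDs : 𝔬.Dstar U = 𝔬'.Dstar U)
    -- numerics
    (hδ₀ : 0 ≤ δ₀) (hα₁ : 0 ≤ α₁) (hα₁1 : α₁ ≤ 1) (hNF : 0 ≤ NF) (hθ₀ : 0 ≤ θ₀) (hNH : 0 ≤ NH) (hNI : 0 ≤ NI)
    (hM : 1 ≤ g.M) (hC : 0 ≤ C) (hδ : 0 ≤ δ) (hδle : δ ≤ (1 - α₁) * δ₀) (hαδ : 0 ≤ α * δ) (hαδ1 : α * δ ≤ δ)
    (hρ : ρ ≤ (1 - α) * δ)
    (hBl : ∀ β, 0 ≤ β → β < 1 → 0 ≤ Bl β) (hθH : ∀ β, 0 ≤ β → β < 1 → 0 ≤ θH β)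
    (hBI : ∀ ε, 0 < ε → ε ≤ 1 → 0 ≤ BI ε) (hBI2 : ∀ ε β, 0 < ε → ε ≤ 1 → 0 ≤ β → β < 1 → 0 ≤ BI2 ε β)
    (hθI : ∀ ε, 0 < ε → 0 ≤ θI ε)
    -- the member's static data ([4] (2.46), (2.54), Lemma 2.1; the member facts of p. 398's transfer)
    (hs : StaticOK310 𝔬' ρ' N N' NF Cℓ κ)
    (hcntH : ∀ a : g.Site, (∑ i, if a ∈ SH i then (1 : ℝ) else 0) ≤ NH)
    (hcntI : ∀ a : g.Site, (∑ i, if a ∈ SI i then (1 : ℝ) else 0) ≤ NI)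
    (h261 : Ineq261 d₁ (toB6 g R H) δ₀ α₁) (hq : NF * (θ₀ * g.M⁻¹) * B6.c1 d₁ δ₀ α₁ ≤ 1 / 2)
    (hF : Facts347 g R H d δ α L₀)
    -- rows 18–19's Theorem-3.10 schemas at U (n06-k) and the sum's (3.42) majorants
    (hf : Factors389 𝔬' R H θ₀ δ₀ U) (hi : Identities310 𝔬' R H U)
    (hL : HolderLegs310 𝔬' 𝔭 R H SH Bl δ₀ U) (hFH : FactorsHolder310 𝔬' 𝔭 R H θH δ₀ U)
    (hIL : InputLegsPair310 𝔬' 𝔡 𝔭 R H bHX SI BI BI2 δ₀ U) (hFI : FactorsInputPair310 𝔬' 𝔡 R H bHX θI δ₀ U)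
    (hDS : DirSup310 𝔬' 𝔡 R H U) (hDH : DirSupHolder310 𝔬' 𝔡 𝔭 R H U) (hc : Conv3107 𝔬' R H C δ U) :
    Thm33G0Dir 𝔬 𝔭 𝔡.Dd 𝔡.Dsd R H bHX C (fun β => holderConst d₁ δ₀ α₁ NH NF C (Bl β) (θH β))
      (fun ε => inputConst44 d₁ δ₀ α₁ NI NF C L₀ (BI ε) (θI ε))
      (fun ε β => inputConst45 d₁ δ₀ α₁ NI NF L₀ (holderConst d₁ δ₀ α₁ NH NF C (Bl β) (θH β)) (BI2 ε β) (θI (β + ε))) ρ U := by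
  have hlen : ∀ y : g.Site, 0 ≤ g.len y := fun y => (hs.lenpos y).le
  have hL₀ : 0 ≤ L₀ := le_trans (le_trans zero_le_one hF.one_le_L) hF.L_le
  have hρδ : ρ ≤ δ := le_trans hρ (by nlinarith [hαδ])
  have hρ1 : ρ ≤ (1 - α) * δ := hρ
  -- n06-k's (3.43) probe majorants of the sum, at the rate δ of `Conv3107`
  have hHol := holder343_of_local310 𝔬' 𝔭 R H d₁ δ₀ α₁ ρ' N N' NF Cℓ θ₀ NH C δ κ SH Bl θH U hδ₀ hα₁ hα₁1 hNF hθ₀ hNH hM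
    hC hδ hδle hs hcntH hBl hθH h261 hq hf hi hL hFH hc.2.2.1
  -- n06-k's (3.44)∕(3.45) members of the sum per direction pair, at the rate (1 − α)δ
  have hInp := fun (ν μ : P) => inputPair3445_of_local310 𝔬' 𝔡 𝔭 R H bHX d d₁ δ α L₀ δ₀ α₁ ρ' N N' NF Cℓ NI C κ SI
    (fun β => holderConst d₁ δ₀ α₁ NH NF C (Bl β) (θH β)) BI θI BI2 U hδ₀ hα₁ hNF hNI hM hC hδle hαδ hαδ1 hs hcntI
    (fun β hβ0 hβ1 => holderConst_nonneg' hNH hNF hC (hBl β hβ0 hβ1) (hθH β hβ0 hβ1)) hBI hBI2 hθI h261 hF hi hIL hFI hDS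
    hDH hc.2.1 (fun β hβ0 hβ1 => (hHol β hβ0 hβ1).1) ν μ
  have hwk : ∀ (β : ℝ), 0 ≤ β → β < 1 → ∀ a b : g.Site,
      holderConst d₁ δ₀ α₁ NH NF C (Bl β) (θH β) * g.len a ^ (1 - β) * Real.exp (-(δ * g.dist a b)) ≤
        holderConst d₁ δ₀ α₁ NH NF C (Bl β) (θH β) * g.len a ^ (1 - β) * Real.exp (-(ρ * g.dist a b)) :=
    fun β hβ0 hβ1 a b => mul_exp_le_of_rate_le
      (mul_nonneg (holderConst_nonneg' hNH hNF hC (hBl β hβ0 hβ1) (hθH β hβ0 hβ1)) (Real.rpow_nonneg (hlen a) _)) hρδ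
      (hs.dnn a b)
  have hwk1 : ∀ a b : g.Site, C * g.len a * Real.exp (-(δ * g.dist a b)) ≤ C * g.len a * Real.exp (-(ρ * g.dist a b)) :=
    fun a b => mul_exp_le_of_rate_le (mul_nonneg hC (hlen a)) hρδ (hs.dnn a b)
  refine
    { h43L := fun β hβ0 hβ1 => ?_
      h43R := fun β hβ0 hβ1 => ?_
      e1d := fun ν => ?_
      h43d := fun ν β hβ0 hβ1 => ?_
      h44m := fun q ε hε hε1 => ?_
      h45m := fun q ε β hε hε1 hβ0 hβ1 => ?_ }
  · -- Φ^Y_β ∘ ∇_U ∘ G₀ (reassociated by definitional unfolding)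
    rw [hblk, hG0, hD]
    have h : HasMajorantHom (g := toB6 g R H) 𝔬'.blk 𝔭.blkPY (𝔭.ΦY U β ∘ₗ (𝔬'.D U ∘ₗ 𝔬'.G U))
        (fun (a b : g.Site) => holderConst d₁ δ₀ α₁ NH NF C (Bl β) (θH β) * g.len a ^ (1 - β) *
          Real.exp (-(δ * g.dist a b))) := (hHol β hβ0 hβ1).1
    exact hasMajorantHom_mono (g := toB6 g R H) _ _ h (hwk β hβ0 hβ1)
  · rw [hblkY, hG0, hDs]
    exact hasMajorantHom_mono (g := toB6 g R H) _ _ (hHol β hβ0 hβ1).2 (hwk β hβ0 hβ1)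
  · rw [hblk, hG0]
    exact hasMajorantHom_mono (g := toB6 g R H) _ _ (hDS.left _ hc.2.1 ν) hwk1
  · rw [hblk, hG0]
    have h : HasMajorantHom (g := toB6 g R H) 𝔬'.blk 𝔭.blkPX (𝔭.ΦX U β ∘ₗ (𝔡.Dd U ν ∘ₗ 𝔬'.G U))
        (fun (a b : g.Site) => holderConst d₁ δ₀ α₁ NH NF C (Bl β) (θH β) * g.len a ^ (1 - β) *
          Real.exp (-(δ * g.dist a b))) := hDH.probe β _ (hHol β hβ0 hβ1).1 ν
    exact hasMajorantHom_mono (g := toB6 g R H) _ _ h (hwk β hβ0 hβ1)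
  · rw [hblk, hG0]
    exact ((hInp q.1 q.2).1 ε hε hε1).mono fun a b => mul_exp_le_of_rate_le
      (inputConst44_nonneg' hNI hNF hC hL₀ (hBI ε hε hε1) (hθI ε hε)) hρ1 (hs.dnn a b)
  · rw [hG0]
    have hK : 0 ≤ inputConst45 d₁ δ₀ α₁ NI NF L₀ (holderConst d₁ δ₀ α₁ NH NF C (Bl β) (θH β)) (BI2 ε β) (θI (β + ε)) :=
      inputConst45_nonneg' hNI hNF hL₀ (holderConst_nonneg' hNH hNF hC (hBl β hβ0 hβ1) (hθH β hβ0 hβ1))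
        (hBI2 ε β hε hε1 hβ0 hβ1) (hθI (β + ε) (by linarith))
    exact ((hInp q.1 q.2).2 ε β hε hε1 hβ0 hβ1).mono fun a b => by
      have h := mul_exp_le_of_rate_le (δ := (1 - α) * δ) (ρ := ρ) (mul_nonneg hK (Real.rpow_nonneg (hlen a) (-β)))
        hρ1 (hs.dnn a b)
      simpa only [mul_assoc] using h

end Holder

end

end Literature.MathematicalPhysics.QuantumFieldTheory.Balaban1983to89.B9Thm312WholeFromThm310
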